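import Summits.BirchSwinnertonDyer.Rank1Residual.X1.PadicSigmaThreeChart
import Literature.NumberTheory.EllipticCurves.UniversalOrdinaryRing
import HarnessLib

/-!
# The universal ordinary `a₂`-family at `p = 3`: the ring `R̂₃ = ℤ[Y, A₄, A₆][1/Y]^₃`, its chart,
# completeness, integrality, torsion, units (module M2a of the x1a design for the Mazur–Tate sigma
# function at `p = 3`)

HONEST FRAMING (cell `b2b-bsdres`, run/shared/lean/b2b/bsd-rank1-residual/, verbatim in every file):
the goal of the cell is to DELETE the COMBINATION-SHAPED residual classes of the Birch–Swinnerton-Dyer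
formula for ALL analytic-rank `≤ 1` elliptic curves over `ℚ` — "full BSD formula for every rank `≤ 1`
curve in class `C`" assembled STRICTLY from published theorems — so that the rank-`≤ 1` remainder
becomes exactly the CONSTRUCTION-SHAPED classes, which are TYPED (missing-input `Prop`s), NOT
attempted. This is not "finishing BSD". CLASS-OWNERS.md row "X1 (r = 1)": research route; NO CLAIM
BEYOND STATED CLASSES; nothing is booked by this file; no preprint enters; no named fact.

Unit `b2b-bsdres-x1a` (X1 prover A, gen 20). WHY. Blakestad–Grant's proof of the integrality of the
Mazur–Tate sigma function (tree: `UniversalOrdinaryRing`, …, `mazur_tate_sigma_existsUnique_holds`,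
`p ≥ 5`) works over the `p`-adic completion `R̂` of `ℤ[A₄, A₆][1/H]` because a Frobenius lift `α` lives
there (a single curve over `ℤ_p` has none). At `p = 3` the short family is empty (`H ≡ 0`); the chart of
`X1/PadicSigmaThreeChart.lean` replaces `(A₄, A₆; H)` by `(Y, A₄, A₆; Y)`: the ordinary `a₂`-family is
charted by `Y = 3·x(P)` (a unit), `A₄`, `A₆`, with `a₂ = -(Y⁴ + 18A₄Y² - 27A₄² + 108A₆Y)/(4(Y³ + 27A₆))`.
This file builds the base ring EXACTLY as the tree builds Blakestad–Grant's (same Mathlib objects,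
same generic completion facts `Literature.RingTheory.AdicTopology.PrincipalCompletion`), one variable more
and with the Hasse polynomial replaced by the variable `Y`:
* `coeffRing = ℤ[Y, A₄, A₆]` (`MvPolynomial (Fin 3) ℤ`), `Yv`, `A4v`, `A6v`; `(3)` is prime and
  `Y ∉ (3)` (a variable), so `localizedRing = ℤ[Y, A₄, A₆][1/Y]` is a domain with `(3)` prime and no
  `3`-torsion;
* **`completeRing = R̂₃`**, the `3`-adic completion: `IsAdicComplete (3)`, a DOMAIN, `(3)` prime,
  `charP_quotient`, **no additive torsion**, `Y`, `Y³ + 27A₆` and `2` units;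
* `univY`, `univA4`, `univA6`, `isUnit_univY`, `isUnit_E` (`Y³ + 27A₆ ≡ Y³` is a unit), `isUnit_two`.
Sequel `X1/PadicSigmaThreeUniversalChart.lean`: the universal chart `univChart : Chart R̂₃`, the universal
curve and the unit Hasse coefficients, the specialisations `R̂₃ → A` (Blakestad–Grant Thm 15) and the
Frobenius congruences of its endomorphisms (Def. 8).

References: C. Blakestad, D. Grant, J. Number Theory 249 (2023) 348–376, §2.1–2.2, Def. 8, Thm. 15
[BlakestadGrant2023]; the tree file `Literature/NumberTheory/EllipticCurves/UniversalOrdinaryRing.lean`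
(whose constructions and proofs are repeated here with `(Fin 3, Y)` for `(Fin 2, H)`).
HOME/b2b-bsdres-x1a/gen20/A34-P3-DESIGN.md §4; X1-CHAIN §29.

Definitions (all with bodies): `coeffRing`, `Yv`, `A4v`, `A6v`, `localizedRing`, `completeRing`, `univY`,
`univA4`, `univA6`. No named facts, no `sorry`.
-/

noncomputable section

open Polynomial

namespace Summit.BirchSwinnertonDyer.Rank1Residual.X1.PadicSigmaThree.Universal

open Literature.RingTheory.AdicTopology Literature.NumberTheory.EllipticCurves

/-! ## `ℤ[Y, A₄, A₆]` -/

/-- **`ℤ[Y, A₄, A₆]`**, the coefficient ring of the chart. [cite: BlakestadGrant2023, §2.1] -/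
abbrev coeffRing : Type := MvPolynomial (Fin 3) ℤ

/-- The variable `Y` (`= 3·x(P)`). [cite: BlakestadGrant2023, §2.1] -/
def Yv : coeffRing := MvPolynomial.X 0

/-- The variable `A₄`. [cite: BlakestadGrant2023, §2.1] -/
def A4v : coeffRing := MvPolynomial.X 1

/-- The variable `A₆`. [cite: BlakestadGrant2023, §2.1] -/
def A6v : coeffRing := MvPolynomial.X 2

/-- The kernel of reduction `ℤ[Y,A₄,A₆] → 𝔽_p[Y,A₄,A₆]` is `(p)`. [folklore] -/
theorem ker_map_castRingHom (p : ℕ) :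
    RingHom.ker (MvPolynomial.map (σ := Fin 3) (Int.castRingHom (ZMod p))) = Ideal.span {(p : coeffRing)} := by
  rw [MvPolynomial.ker_map, ZMod.ker_intCastRingHom, Ideal.map_span, Set.image_singleton, map_natCast]

/-- `(p)` is a prime ideal of `ℤ[Y, A₄, A₆]`. [folklore] -/
theorem span_natCast_isPrime (p : ℕ) [Fact p.Prime] : (Ideal.span {(p : coeffRing)}).IsPrime := by
  rw [← ker_map_castRingHom]
  exact RingHom.ker_isPrime _

/-- `Y ≢ 0 (mod p)` (a variable). [folklore] -/
theorem Yv_map_ne_zero (p : ℕ) [Fact p.Prime] : MvPolynomial.map (Int.castRingHom (ZMod p)) Yv ≠ 0 := by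
  rw [Yv, MvPolynomial.map_X]
  exact MvPolynomial.X_ne_zero _

/-- `Y ≠ 0`. [folklore] -/
theorem Yv_ne_zero : Yv ≠ 0 := by
  rw [Yv]; exact MvPolynomial.X_ne_zero _

/-- `Y ∉ (p)`. [folklore] -/
theorem Yv_not_mem_span (p : ℕ) [Fact p.Prime] : Yv ∉ Ideal.span {(p : coeffRing)} := by
  rw [← ker_map_castRingHom, RingHom.mem_ker]
  exact Yv_map_ne_zero p

/-- The powers of `Y` avoid `(p)`. [folklore] -/
theorem disjoint_powers_Yv_span (p : ℕ) [Fact p.Prime] :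
    Disjoint (Submonoid.powers Yv : Set coeffRing) ↑(Ideal.span {(p : coeffRing)}) := by
  rw [Set.disjoint_left]
  rintro x ⟨k, rfl⟩ hx
  exact Yv_not_mem_span p ((span_natCast_isPrime p).mem_of_pow_mem k hx)

/-- `p ≠ 0` in `ℤ[Y, A₄, A₆]`. [folklore] -/
theorem natCast_ne_zero {p : ℕ} (hp : p ≠ 0) : (p : coeffRing) ≠ 0 := by
  rw [← map_natCast (MvPolynomial.C : ℤ →+* coeffRing), Ne, MvPolynomial.C_eq_zero, Nat.cast_eq_zero]
  exact hp

/-! ## `ℤ[Y, A₄, A₆][1/Y]` -/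

/-- **`ℤ[Y, A₄, A₆][1/Y]`**. [cite: BlakestadGrant2023, §2.1] -/
abbrev localizedRing : Type := Localization.Away Yv

/-- `ℤ[Y,A₄,A₆][1/Y]` is a domain. [folklore] -/
instance isDomain_localizedRing : IsDomain localizedRing :=
  IsLocalization.isDomain_localization (powers_le_nonZeroDivisors_of_noZeroDivisors Yv_ne_zero)

/-- `ℤ[Y,A₄,A₆] → ℤ[Y,A₄,A₆][1/Y]` is injective. [folklore] -/
theorem algebraMap_localizedRing_injective : Function.Injective (algebraMap coeffRing localizedRing) :=
  IsLocalization.injective localizedRing (powers_le_nonZeroDivisors_of_noZeroDivisors Yv_ne_zero)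

/-- `(p)` is a prime ideal of `ℤ[Y,A₄,A₆][1/Y]`. [folklore] -/
theorem span_natCast_isPrime_localizedRing (p : ℕ) [Fact p.Prime] :
    (Ideal.span {(p : localizedRing)}).IsPrime := by
  have h := IsLocalization.isPrime_of_isPrime_disjoint (Submonoid.powers Yv) localizedRing
    (Ideal.span {(p : coeffRing)}) (span_natCast_isPrime p) (disjoint_powers_Yv_span p)
  rwa [Ideal.map_span, Set.image_singleton, map_natCast] at h

/-- `ℤ[Y,A₄,A₆][1/Y]` has no `p`-torsion. [folklore] -/
theorem eq_zero_of_natCast_mul_eq_zero (p : ℕ) [Fact p.Prime] (x : localizedRing)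
    (hx : (p : localizedRing) * x = 0) : x = 0 := by
  have hp0 : (p : localizedRing) ≠ 0 := by
    rw [← map_natCast (algebraMap coeffRing localizedRing), Ne, ← (algebraMap coeffRing localizedRing).map_zero,
      algebraMap_localizedRing_injective.eq_iff]
    exact natCast_ne_zero (Fact.out : p.Prime).ne_zero
  exact (mul_eq_zero.mp hx).resolve_left hp0

/-- `Y` is a unit of `ℤ[Y,A₄,A₆][1/Y]`. [folklore] -/
theorem isUnit_algebraMap_Yv : IsUnit (algebraMap coeffRing localizedRing Yv) :=
  IsLocalization.Away.algebraMap_isUnit Yv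

/-! ## `R̂₃`, the `3`-adic completion -/

/-- **`R̂₃`, the `3`-adic completion of `ℤ[Y, A₄, A₆][1/Y]`** — the base of the universal ordinary
`a₂`-family at `p = 3`. [cite: BlakestadGrant2023, §2.1] -/
abbrev completeRing : Type := AdicCompletion (Ideal.span {((3 : ℕ) : localizedRing)}) localizedRing

/-- `R̂₃` is `3`-adically complete. [folklore] -/
instance isAdicComplete_completeRing : IsAdicComplete (Ideal.span {((3 : ℕ) : completeRing)}) completeRing :=
  isAdicComplete_span_natCast localizedRing 3

/-- The same instance with the literal `3`. [folklore] -/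
instance isAdicComplete_completeRing' : IsAdicComplete (Ideal.span {(3 : completeRing)}) completeRing :=
  isAdicComplete_span_natCast localizedRing 3

/-- `ℤ[Y,A₄,A₆] → R̂₃` factors through the localisation. [folklore] -/
theorem algebraMap_coeffRing_apply (q : coeffRing) :
    algebraMap coeffRing completeRing q = algebraMap localizedRing completeRing (algebraMap coeffRing localizedRing q) := by
  rw [AdicCompletion.algebraMap_apply, AdicCompletion.algebraMap_apply, Algebra.algebraMap_self, RingHom.id_apply]

/-- `Y ∈ R̂₃`. [cite: BlakestadGrant2023, §2.1] -/
def univY : completeRing := algebraMap coeffRing completeRing Yv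

/-- `A₄ ∈ R̂₃`. [cite: BlakestadGrant2023, §2.1] -/
def univA4 : completeRing := algebraMap coeffRing completeRing A4v

/-- `A₆ ∈ R̂₃`. [cite: BlakestadGrant2023, §2.1] -/
def univA6 : completeRing := algebraMap coeffRing completeRing A6v

/-- **`Y` is a unit of `R̂₃`.** [cite: BlakestadGrant2023, §2.1] -/
theorem isUnit_univY : IsUnit univY := by
  rw [univY, algebraMap_coeffRing_apply]
  exact isUnit_algebraMap_Yv.map _

/-- `3` is prime (instance for the `p`-adic API). [folklore] -/
instance fact_prime_three : Fact (Nat.Prime 3) := ⟨Nat.prime_three⟩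

/-- `(3) ⊂ R̂₃` is prime. [folklore] -/
theorem span_natCast_isPrime_completeRing : (Ideal.span {(3 : completeRing)}).IsPrime := by
  haveI := span_natCast_isPrime_localizedRing 3
  have h := span_algebraMap_isPrime ((3 : ℕ) : localizedRing)
  rwa [algebraMap_natCast, Nat.cast_ofNat] at h

/-- **`R̂₃` is an integral domain.** [cite: BlakestadGrant2023, §2.2] -/
instance isDomain_completeRing : IsDomain completeRing :=
  haveI := span_natCast_isPrime_localizedRing 3
  isDomain_natCast localizedRing 3 (eq_zero_of_natCast_mul_eq_zero 3)

/-- `3` is not a unit of `R̂₃`. [folklore] -/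
theorem three_mem_nonunits : (3 : completeRing) ∈ nonunits completeRing :=
  fun hu => span_natCast_isPrime_completeRing.ne_top
    (Ideal.eq_top_of_isUnit_mem _ (Ideal.mem_span_singleton_self _) hu)

/-- `R̂₃/(3)` has characteristic `3`. [folklore] -/
theorem charP_quotient : CharP (completeRing ⧸ Ideal.span {(3 : completeRing)}) 3 :=
  CharP.quotient completeRing 3 three_mem_nonunits

/-- `3ᵏ x = 0 ↔ x = 0` in `R̂₃`. [folklore] -/
theorem pow_mul_eq_zero_iff_completeRing (k : ℕ) (x : completeRing) : ((3 : ℕ) : completeRing) ^ k * x = 0 ↔ x = 0 :=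
  natCast_pow_mul_eq_zero_iff localizedRing 3 (eq_zero_of_natCast_mul_eq_zero 3) k x

/-- **`R̂₃` has no additive torsion.** [folklore] -/
instance isAddTorsionFree_completeRing : IsAddTorsionFree completeRing := by
  refine ⟨fun n hn a b hab => ?_⟩
  have h0 : (n : completeRing) * (a - b) = 0 := by
    have hab' : n • a = n • b := hab
    rw [mul_sub, ← nsmul_eq_mul, ← nsmul_eq_mul, hab', sub_self]
  obtain ⟨k, m, hm, rfl⟩ := Nat.exists_eq_pow_mul_and_not_dvd hn 3 (by norm_num)
  have hmu : IsUnit (m : completeRing) :=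
    isUnit_natCast_of_coprime (p := 3) ((Nat.Prime.coprime_iff_not_dvd Nat.prime_three).mpr hm).symm
  rw [Nat.cast_mul, Nat.cast_pow, mul_assoc, pow_mul_eq_zero_iff_completeRing,
    hmu.mul_right_eq_zero, sub_eq_zero] at h0
  exact h0

/-- `R̂₃` is `3`-adically separated: `(∀ n, c ∈ (3^{n+1})) → c = 0` (the hypothesis `hsep` of the tree's
Prop. 13(a)). [folklore] -/
theorem eq_zero_of_forall_mem_pow (c : completeRing) (h : ∀ n : ℕ, c ∈ Ideal.span {(3 : completeRing) ^ (n + 1)}) :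
    c = 0 := by
  refine IsHausdorff.haus' (I := Ideal.span {(3 : completeRing)}) c fun n => ?_
  rw [SModEq.zero, smul_eq_mul, Ideal.mul_top, Ideal.span_singleton_pow]
  rcases n with _ | n
  · rw [pow_zero, Ideal.span_singleton_one]; exact Submodule.mem_top
  · exact h n

/-- `2` is a unit of `R̂₃`. [folklore] -/
theorem isUnit_two : IsUnit (2 : completeRing) :=
  isUnit_natCast_of_coprime (R := completeRing) (p := 3) (m := 2) (by norm_num)

/-- **`Y³ + 27A₆` is a unit of `R̂₃`** (`≡ Y³ (mod 3)`). [folklore] -/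
theorem isUnit_E : IsUnit (univY ^ 3 + 27 * univA6) := by
  refine isUnit_of_isUnit_mk (Ideal.span {(3 : completeRing)}) ?_
  have h27 : Ideal.Quotient.mk (Ideal.span {(3 : completeRing)}) (27 * univA6) = 0 :=
    Ideal.Quotient.eq_zero_iff_mem.mpr (Ideal.mem_span_singleton.mpr ⟨9 * univA6, by ring⟩)
  rw [map_add, h27, add_zero, map_pow]
  exact (isUnit_univY.map _).pow 3

end Summit.BirchSwinnertonDyer.Rank1Residual.X1.PadicSigmaThree.Universal

end
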